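import Literature.GroupTheory.CombinatorialGroupTheory.CyclicBlockInterchangeTracking
import Mathlib.Combinatorics.Hall.Basic
import HarnessLib

/-!
# The binary encoding `λ` preserves the cyclic block interchange distance (Heuer 2020, Lemma 4.6)

[Heuer2020, §4.2]: for the alphabets `A = {a, b, c, d}` and `B = {x, y}` and a positive word
`v = v₁ ⋯ vₙ ∈ A⁺`, "`λ(v) = (x y^{ε_{v₁}} x)^{K} ⋯ (x y^{ε_{vₙ}} x)^{K}`" with
`ε_a, ε_b, ε_c, ε_d = 2, 3, 4, 5` and `K = 4n² + 1`; **Lemma 4.6**: for related `v, w`,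
`d_cbi(λ(v), λ(w)) = d_cbi(v, w)`. This file proves the lemma for any injective exponent
function `ε ≥ 1` and any repetition `K > 4 d_cbi` — the printed proof's count "at most `4n` cuts"
is used in the sharper form "at most `4t` copies are ever cut IN TOTAL", which makes Hall's
condition hold as soon as `K > 4t` (the printed `K = 4n² + 1` also works):

* `CBI.hcode ε b = x y^{ε b} x`, `CBI.lam ε K v` (the encoding), lengths and letters by position
  (`CBI.lam_getElem`), the decomposition of positions into (letter, copy, offset);
* the easy inequality `d_cbi(λv, λw) ≤ d_cbi(v, w)` (`CBI.Reach.lam`: an interchange of `v` is an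
  interchange of `λ(v)`);
* **recognisability**: a factor `x yᵉ x` of `λ(w)` starts at a block copy of a letter `w_j` with
  `ε(w_j) = e` (`CBI.exists_block_of_factor`; no factor wraps around, `CBI.not_wrap`);
* the hard inequality (`CBI.reach_of_reach_lam`): track the `K · n` copies through an optimal
  sequence (`CyclicBlockInterchangeTracking.lean`: at most `4t` casualties, survivors move rigidly
  and land on block copies of equal letters), choose by **Hall's marriage theorem** (Mathlib's
  `Finset.all_card_le_biUnion_card_iff_exists_injective`; [Heuer2020, Claim 4.7]) one survivor per
  letter of `v` landing in pairwise distinct letters of `w` — whence `v, w` are related — and read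
  the sequence on the chosen survivors (`readMarks`), which is a sequence of `t` cyclic block
  interchanges from `v` to `w`;
* **`CBI.dcbi_lam_eq`**: `d_cbi(λ(v), λ(w)) = d_cbi(v, w)` for related `v, w` and `K > 4 d_cbi(v,w)`,
  and the decision form used by the reduction CBI-`F₄ ≤ₚ` CBI-`F₂` (`CBI.dcbi_lam_le_iff`).

Everything here is proved; no named facts.

## References

* [Heuer2020] N. Heuer, *Computing commutator length is hard*, arXiv:2001.10230, §4.2 (Lemma 4.6,
  Claim 4.7).
* [Hall1935] P. Hall, *On representatives of subsets*, J. London Math. Soc. 10 (1935) — via Mathlib.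
-/

namespace Literature.GroupTheory.CombinatorialGroupTheory

namespace CBI

open Equiv Equiv.Perm

variable {β : Type*}

/-! ### The encoding -/

/-- The code of a letter: `x y^{ε b} x` over `{x, y} = {0, 1}`. [cite: Heuer2020, §4.2] -/
def hcode (ε : β → ℕ) (b : β) : List (Fin 2) := 0 :: (List.replicate (ε b) 1 ++ [0])

/-- Length of a letter code: `ε b + 2`. [folklore] -/
@[simp] theorem length_hcode (ε : β → ℕ) (b : β) : (hcode ε b).length = ε b + 2 := by
  simp [hcode]

/-- **The encoding `λ`**: `K` consecutive copies of the code of each letter. [cite: Heuer2020, §4.2] -/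
def lam (ε : β → ℕ) (K : ℕ) (v : List β) : List (Fin 2) :=
  v.flatMap fun b => (List.replicate K (hcode ε b)).flatten

/-- `λ` of a concatenation. [folklore] -/
theorem lam_append (ε : β → ℕ) (K : ℕ) (v w : List β) : lam ε K (v ++ w) = lam ε K v ++ lam ε K w := by
  simp [lam]

/-- `λ` of the empty word. [folklore] -/
@[simp] theorem lam_nil (ε : β → ℕ) (K : ℕ) : lam ε K ([] : List β) = [] := rfl

/-! ### The easy inequality: interchanges of `v` are interchanges of `λ(v)` -/

/-- A block interchange of `v` is a block interchange of `λ(v)`. [cite: Heuer2020, Lemma 4.6] -/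
theorem IsBlockInterchange.lam (ε : β → ℕ) (K : ℕ) {v u : List β} (h : IsBlockInterchange v u) :
    IsBlockInterchange (lam ε K v) (lam ε K u) := by
  obtain ⟨w₁, w₂, w₃, w₄, rfl, rfl⟩ := h
  exact ⟨CBI.lam ε K w₁, CBI.lam ε K w₂, CBI.lam ε K w₃, CBI.lam ε K w₄, by simp [lam_append], by simp [lam_append]⟩

/-- A rotation of `v` gives a rotation of `λ(v)`. [folklore] -/
theorem isRotated_lam (ε : β → ℕ) (K : ℕ) {v u : List β} (h : List.IsRotated v u) : List.IsRotated (lam ε K v) (lam ε K u) := by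
  obtain ⟨k, rfl⟩ := h
  rcases Nat.lt_or_ge k v.length with hk | hk
  · rw [List.rotate_eq_drop_append_take hk.le, lam_append]
    conv_lhs => rw [← List.take_append_drop k v, lam_append]
    exact List.isRotated_append
  · rcases Nat.eq_zero_or_pos v.length with h0 | h0
    · rw [List.length_eq_zero_iff.1 h0]
      simp
    · rw [← List.rotate_mod, List.rotate_eq_drop_append_take (Nat.mod_lt _ h0).le, lam_append]
      conv_lhs => rw [← List.take_append_drop (k % v.length) v, lam_append]
      exact List.isRotated_append

/-- A cyclic block interchange of `v` is one of `λ(v)`. [cite: Heuer2020, Lemma 4.6] -/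
theorem IsCBI.lam (ε : β → ℕ) (K : ℕ) {v u : List β} (h : IsCBI v u) : IsCBI (lam ε K v) (lam ε K u) := by
  obtain ⟨v', u', hv, hu, hbi⟩ := h
  exact ⟨_, _, isRotated_lam ε K hv, isRotated_lam ε K hu, hbi.lam ε K⟩

/-- **`d_cbi(λ v, λ w) ≤ d_cbi(v, w)`**, as sequences. [cite: Heuer2020, Lemma 4.6] -/
theorem Reach.lam (ε : β → ℕ) (K : ℕ) : ∀ {t : ℕ} {v w : List β}, Reach t v w → Reach t (lam ε K v) (lam ε K w)
  | 0, _, _, h => isRotated_lam ε K h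
  | _ + 1, _, _, ⟨_, h₁, h₂⟩ => ⟨_, h₁.lam ε K, Reach.lam ε K h₂⟩

/-- **`d_cbi(λ v, λ w) ≤ d_cbi(v, w)`** for related words. [cite: Heuer2020, Lemma 4.6] -/
theorem dcbi_lam_le (ε : β → ℕ) (K : ℕ) {v w : List β} (h : List.Perm v w) :
    dcbi (lam ε K v) (lam ε K w) ≤ dcbi v w :=
  dcbi_le_of_reach ((reach_dcbi h).lam ε K)

/-! ### Positions of `λ(v)`: letter, copy, offset -/

section Positions

variable (ε : β → ℕ) (K : ℕ)

/-- The length `ε b + 2` of a letter code. [folklore] -/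
def clen (b : β) : ℕ := ε b + 2

/-- The offset of the copies of the `i`-th letter: the length of the encoding of the prefix. [folklore] -/
def offV (v : List β) (i : ℕ) : ℕ := (lam ε K (v.take i)).length

/-- `K` copies of a code have `K · |code|` letters. [folklore] -/
theorem length_flatten_replicate (cd : List (Fin 2)) : (List.replicate K cd).flatten.length = K * cd.length := by
  induction K with
  | zero => simp
  | succ K ih => simp [List.replicate_succ, Nat.succ_mul]; omega

/-- `λ` of a cons. [folklore] -/
theorem lam_cons (b : β) (v : List β) : lam ε K (b :: v) = (List.replicate K (hcode ε b)).flatten ++ lam ε K v := by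
  simp [lam]

/-- Length of `λ(v)`: the offsets telescope. [folklore] -/
theorem length_lam (v : List β) : (lam ε K v).length = offV ε K v v.length := by
  rw [offV, List.take_length]

/-- `offV 0 = 0`. [folklore] -/
@[simp] theorem offV_zero (v : List β) : offV ε K v 0 = 0 := by simp [offV]

/-- The offsets step by `K · (ε vᵢ + 2)`. [folklore] -/
theorem offV_succ (v : List β) {i : ℕ} (hi : i < v.length) :
    offV ε K v (i + 1) = offV ε K v i + K * clen ε v[i] := by
  rw [offV, offV, List.take_succ_eq_append_getElem hi, lam_append, List.length_append, lam_cons, lam_nil,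
    List.append_nil, length_flatten_replicate, length_hcode, clen]

/-- The offsets are monotone. [folklore] -/
theorem offV_mono (v : List β) {i j : ℕ} (hij : i ≤ j) (hj : j ≤ v.length) : offV ε K v i ≤ offV ε K v j := by
  induction j with
  | zero =>
    obtain rfl : i = 0 := Nat.le_zero.1 hij
    exact le_rfl
  | succ j ih =>
    rcases Nat.lt_or_ge i (j + 1) with h | h
    · exact (ih (Nat.lt_succ_iff.1 h) (Nat.le_of_succ_le hj)).trans (by rw [offV_succ ε K v hj]; exact Nat.le_add_right _ _)
    · rw [le_antisymm hij h]

/-- Offsets beyond the length. [folklore] -/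
theorem offV_of_length_le (v : List β) {i : ℕ} (hi : v.length ≤ i) : offV ε K v i = offV ε K v v.length := by
  rw [offV, offV, List.take_of_length_le hi, List.take_length]

/-- Letters of `K` copies of a code. [folklore] -/
theorem getElem_flatten_replicate (cd : List (Fin 2)) {m o : ℕ} (hm : m < K) (ho : o < cd.length)
    (h : m * cd.length + o < (List.replicate K cd).flatten.length) :
    (List.replicate K cd).flatten[m * cd.length + o] = cd[o] := by
  induction K generalizing m with
  | zero => omega
  | succ K ih =>
    simp only [List.replicate_succ, List.flatten_cons]
    rcases Nat.eq_zero_or_pos m with rfl | hm0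
    · rw [List.getElem_append_left (by simpa using ho)]
      simp
    · have e : m * cd.length + o = cd.length + ((m - 1) * cd.length + o) := by
        rw [Nat.sub_one_mul]
        have := Nat.le_mul_of_pos_left cd.length hm0
        omega
      simp only [e]
      rw [List.getElem_append_right (by omega)]
      simp only [Nat.add_sub_cancel_left]
      exact ih (by omega) _

/-- **Letters of `λ(v)` by position**: the letter at `offV i + m (ε vᵢ + 2) + o` is `(x y^{ε vᵢ} x)[o]`. [cite: Heuer2020, §4.2] -/
theorem lam_getElem (v : List β) {i m o : ℕ} (hi : i < v.length) (hm : m < K) (ho : o < clen ε v[i])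
    (h : offV ε K v i + m * clen ε v[i] + o < (lam ε K v).length) :
    (lam ε K v)[offV ε K v i + m * clen ε v[i] + o] = (hcode ε v[i])[o]'(by rw [length_hcode]; exact ho) := by
  have hsplit : lam ε K v = lam ε K (v.take i) ++ ((List.replicate K (hcode ε v[i])).flatten ++ lam ε K (v.drop (i + 1))) := by
    conv_lhs => rw [← List.take_append_drop i v, lam_append, List.drop_eq_getElem_cons hi, lam_cons]
  have e : offV ε K v i + m * clen ε v[i] + o = (lam ε K (v.take i)).length + (m * clen ε v[i] + o) := by
    rw [offV, add_assoc]
  simp only [e]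
  rw [List.getElem_of_eq hsplit, List.getElem_append_right (by omega)]
  simp only [Nat.add_sub_cancel_left]
  have hlt : m * clen ε v[i] + o < (List.replicate K (hcode ε v[i])).flatten.length := by
    rw [length_flatten_replicate, length_hcode]
    have h1 : (m + 1) * clen ε v[i] ≤ K * clen ε v[i] := Nat.mul_le_mul_right _ hm
    simp only [clen] at h1 ho ⊢
    rw [Nat.succ_mul] at h1
    omega
  rw [List.getElem_append_left hlt]
  have e2 : m * clen ε v[i] + o = m * (hcode ε v[i]).length + o := by rw [length_hcode, clen]
  simp only [e2]
  exact getElem_flatten_replicate K (hcode ε v[i]) hm (by rw [length_hcode]; exact ho) _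

/-- **Every position of `λ(v)` decomposes** as `offV i + m (ε vᵢ + 2) + o`. [folklore] -/
theorem exists_decomp (v : List β) {P : ℕ} (hP : P < (lam ε K v).length) :
    ∃ (i : ℕ) (hi : i < v.length) (m o : ℕ), m < K ∧ o < clen ε v[i] ∧ P = offV ε K v i + m * clen ε v[i] + o := by
  induction v generalizing P with
  | nil => simp at hP
  | cons b v ih =>
    rw [lam_cons, List.length_append, length_flatten_replicate, length_hcode] at hP
    by_cases hlt : P < K * (ε b + 2)
    · have hpos : 0 < ε b + 2 := by omega
      refine ⟨0, by simp, P / (ε b + 2), P % (ε b + 2), ?_, ?_, ?_⟩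
      · exact Nat.div_lt_of_lt_mul (by rw [Nat.mul_comm]; exact hlt)
      · simp [clen, Nat.mod_lt _ hpos]
      · simp only [offV_zero, List.getElem_cons_zero, clen, Nat.zero_add]
        exact (Nat.div_add_mod P (ε b + 2)).symm.trans (by ring)
    · obtain ⟨i, hi, m, o, hm, ho, hP'⟩ := ih (P := P - K * (ε b + 2)) (by omega)
      refine ⟨i + 1, by simp; omega, m, o, hm, by simpa using ho, ?_⟩
      have hoff : offV ε K (b :: v) (i + 1) = K * (ε b + 2) + offV ε K v i := by
        rw [offV, offV, List.take_succ_cons, lam_cons, List.length_append, length_flatten_replicate, length_hcode]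
      rw [hoff]
      simp only [List.getElem_cons_succ]
      omega

/-- The letters of a code: `x` exactly at the two ends. [folklore] -/
theorem hcode_getElem_eq_zero_iff (b : β) {o : ℕ} (ho : o < clen ε b) :
    (hcode ε b)[o]'(by rw [length_hcode]; exact ho) = 0 ↔ o = 0 ∨ o = ε b + 1 := by
  rw [clen] at ho
  rcases Nat.eq_zero_or_pos o with rfl | h0
  · simp [hcode]
  · have : (hcode ε b)[o]'(by rw [length_hcode]; omega) = (List.replicate (ε b) (1 : Fin 2) ++ [0])[o - 1]'(by simp; omega) := by
      simp only [hcode]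
      rw [List.getElem_cons]
      rw [dif_neg (by omega)]
    rw [this]
    by_cases h1 : o - 1 < ε b
    · rw [List.getElem_append_left (by simpa using h1), List.getElem_replicate]
      simp only [Fin.isValue, Fin.one_eq_zero_iff, OfNat.ofNat_ne_one, false_iff, not_or]
      omega
    · rw [List.getElem_append_right (by simpa using h1)]
      simp only [List.length_replicate, Fin.isValue, List.getElem_singleton, true_iff]
      omega

end Positions

/-! ### Recognising the code of a letter inside `λ(w)` -/

section Recognise

variable (ε : β → ℕ) (K : ℕ)

/-- A letter of `{x, y}` that is not `x` is `y`. [folklore] -/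
theorem fin2_eq_one_of_ne_zero {z : Fin 2} (h : z ≠ 0) : z = 1 := by
  match z with
  | 0 => exact absurd rfl h
  | 1 => rfl

/-- Interior letters of a code are `y`. [folklore] -/
theorem hcode_getElem_eq_one (b : β) {o : ℕ} (ho : o < clen ε b) (h1 : o ≠ 0) (h2 : o ≠ ε b + 1) :
    (hcode ε b)[o]'(by rw [length_hcode]; exact ho) = 1 :=
  fin2_eq_one_of_ne_zero fun h => by
    rcases (hcode_getElem_eq_zero_iff ε b ho).1 h with h | h
    · exact h1 h
    · exact h2 h

variable {ε K}

/-- **Recognisability**: a factor `x y^{ε b} x` of `λ(w)` starts at a block copy of a letter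
`w_j` with `ε(w_j) = ε(b)` (`ε ≥ 1`, `K ≥ 1`). [cite: Heuer2020, Lemma 4.6] -/
theorem exists_block_of_factor (he1 : ∀ b, 1 ≤ ε b) (w : List β) (b : β) {Q : ℕ}
    (hQ : Q + clen ε b ≤ (lam ε K w).length)
    (hfac : ∀ o (ho : o < clen ε b), (lam ε K w)[Q + o]'(by omega) = (hcode ε b)[o]'(by rw [length_hcode]; exact ho)) :
    ∃ (j : ℕ) (hj : j < w.length) (m : ℕ), m < K ∧ Q = offV ε K w j + m * clen ε w[j] ∧ ε w[j] = ε b := by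
  have hcb : 3 ≤ clen ε b := by have := he1 b; simp only [clen]; omega
  have hQ1 : Q + 1 < (lam ε K w).length := by omega
  obtain ⟨j, hj, m, o, hm, ho, hQe⟩ := exists_decomp ε K w (P := Q) (by omega)
  have hcj : 3 ≤ clen ε w[j] := by have := he1 w[j]; simp only [clen]; omega
  -- the letter at `Q` is `x`, so `o = 0` or `o` is the last offset of its copy
  have h0 : (lam ε K w)[Q]'(by omega) = 0 := by
    have := hfac 0 (by omega)
    simpa [hcode] using this
  have hQ' : (lam ε K w)[Q]'(by omega) = (hcode ε w[j])[o]'(by rw [length_hcode]; exact ho) := by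
    simp only [hQe]
    exact lam_getElem ε K w hj hm ho _
  rw [hQ', hcode_getElem_eq_zero_iff ε w[j] ho] at h0
  -- the letter at `Q + 1` is `y`
  have h1 : (lam ε K w)[Q + 1]'hQ1 = 1 := by
    rw [hfac 1 (by omega)]
    exact hcode_getElem_eq_one ε b (by omega) one_ne_zero (by have := he1 b; omega)
  rcases h0 with rfl | rfl
  · -- `o = 0`: a block start; compare the run lengths
    refine ⟨j, hj, m, hm, by rw [hQe, Nat.add_zero], ?_⟩
    rw [Nat.add_zero] at hQe
    by_contra hne
    rcases Nat.lt_or_gt_of_ne hne with hlt | hgt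
    · -- `ε w_j < ε b`: position `Q + ε w_j + 1` is `x` in `λ(w)` but `y` in the factor
      have hA : (lam ε K w)[Q + (ε w[j] + 1)]'(by simp only [clen] at hcb hQ; omega) = 0 := by
        have : (lam ε K w)[Q + (ε w[j] + 1)]'(by simp only [clen] at hcb hQ; omega) =
            (hcode ε w[j])[ε w[j] + 1]'(by rw [length_hcode]; omega) := by
          simp only [hQe]
          exact lam_getElem ε K w hj hm (by simp only [clen]; omega) _
        rw [this, hcode_getElem_eq_zero_iff ε w[j] (by simp only [clen]; omega)]
        exact Or.inr rfl
      have hB := hfac (ε w[j] + 1) (by simp only [clen]; omega)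
      rw [hA] at hB
      exact absurd hB.symm (by
        rw [hcode_getElem_eq_one ε b (by simp only [clen]; omega) (by omega) (by omega)]; decide)
    · -- `ε b < ε w_j`: position `Q + ε b + 1` is `x` in the factor but `y` in `λ(w)`
      have hA : (lam ε K w)[Q + (ε b + 1)]'(by simp only [clen] at hQ; omega) = 1 := by
        have : (lam ε K w)[Q + (ε b + 1)]'(by simp only [clen] at hQ; omega) =
            (hcode ε w[j])[ε b + 1]'(by rw [length_hcode]; omega) := by
          simp only [hQe]
          exact lam_getElem ε K w hj hm (by simp only [clen]; omega) _
        rw [this]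
        exact hcode_getElem_eq_one ε w[j] (by simp only [clen]; omega) (by omega) (by omega)
      have hB := hfac (ε b + 1) (by simp only [clen]; omega)
      have hC : (hcode ε b)[ε b + 1]'(by rw [length_hcode]; omega) = 0 :=
        (hcode_getElem_eq_zero_iff ε b (by simp only [clen]; omega)).2 (Or.inr rfl)
      rw [hA, hC] at hB
      exact absurd hB (by decide)
  · -- `o = ε w_j + 1`: the next letter is the start of a copy, an `x`; but it is `y`
    exfalso
    have hnext : Q + 1 = offV ε K w j + (m + 1) * clen ε w[j] := by
      rw [hQe, Nat.succ_mul, clen]; omega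
    rcases Nat.lt_or_ge (m + 1) K with hmK | hmK
    · have : (lam ε K w)[Q + 1]'hQ1 = (hcode ε w[j])[0]'(by rw [length_hcode]; omega) := by
        have e : Q + 1 = offV ε K w j + (m + 1) * clen ε w[j] + 0 := by rw [hnext]; rfl
        simp only [e]
        exact lam_getElem ε K w hj hmK (by omega) _
      rw [this] at h1
      simp [hcode] at h1
    · have hmK' : m + 1 = K := le_antisymm hm hmK
      rw [hmK', ← offV_succ ε K w hj] at hnext
      rcases Nat.lt_or_ge (j + 1) w.length with hj1 | hj1
      · have : (lam ε K w)[Q + 1]'hQ1 = (hcode ε w[j + 1])[0]'(by rw [length_hcode]; omega) := by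
          have e : Q + 1 = offV ε K w (j + 1) + 0 * clen ε w[j + 1] + 0 := by rw [hnext]; ring
          simp only [e]
          exact lam_getElem ε K w hj1 (by omega) (by simp only [clen]; omega) _
        rw [this] at h1
        simp [hcode] at h1
      · have : Q + 1 = (lam ε K w).length := by
          rw [hnext, length_lam, offV_of_length_le ε K w hj1]
        omega

/-- No two consecutive letters of a code are both `x` (`ε ≥ 1`). [folklore] -/
theorem hcode_no_xx (he1 : ∀ b, 1 ≤ ε b) (b : β) {o : ℕ} (ho : o + 1 < clen ε b)
    (h0 : (hcode ε b)[o]'(by rw [length_hcode, ← clen]; omega) = 0)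
    (h1 : (hcode ε b)[o + 1]'(by rw [length_hcode, ← clen]; omega) = 0) : False := by
  rw [hcode_getElem_eq_zero_iff ε b (by omega)] at h0
  rw [hcode_getElem_eq_zero_iff ε b ho] at h1
  have := he1 b
  omega

/-- The first letter of `λ(w)` is `x`. [folklore] -/
theorem lam_getElem_zero (w : List β) (h : 0 < (lam ε K w).length) : (lam ε K w)[0] = 0 := by
  obtain ⟨j, hj, m, o, hm, ho, hQe⟩ := exists_decomp ε K w h
  have ho0 : o = 0 := by omega
  have hm0 : m * clen ε w[j] = 0 := by omega
  have hoff : offV ε K w j = 0 := by omega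
  have key := lam_getElem ε K w hj hm ho (by omega)
  simp only [ho0, hm0, hoff, Nat.add_zero] at key
  rw [key]
  simp [hcode]

/-- The last letter of `λ(w)` is `x`. [folklore] -/
theorem lam_getElem_last (w : List β) (h : 0 < (lam ε K w).length) :
    (lam ε K w)[(lam ε K w).length - 1] = 0 := by
  obtain ⟨j, hj, m, o, hm, ho, hQe⟩ := exists_decomp ε K w (P := (lam ε K w).length - 1) (by omega)
  have hval : (lam ε K w)[(lam ε K w).length - 1] = (hcode ε w[j])[o]'(by rw [length_hcode]; exact ho) := by
    simp only [hQe]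
    exact lam_getElem ε K w hj hm ho _
  rw [hval, hcode_getElem_eq_zero_iff ε w[j] ho]
  -- the position after the last one would still be inside `λ(w)` unless `o` is the last offset of the last copy
  by_contra hne
  push Not at hne
  have ho' : o + 1 < clen ε w[j] := by simp only [clen] at ho ⊢; omega
  have : offV ε K w j + m * clen ε w[j] + (o + 1) < (lam ε K w).length := by
    have h1 : offV ε K w j + (m + 1) * clen ε w[j] ≤ offV ε K w j + K * clen ε w[j] :=
      Nat.add_le_add_left (Nat.mul_le_mul_right _ hm) _
    rw [← offV_succ ε K w hj] at h1
    have h2 : offV ε K w (j + 1) ≤ (lam ε K w).length := by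
      rw [length_lam]; exact offV_mono ε K w hj le_rfl |>.trans_eq (by rfl) |> fun h => by
        exact offV_mono ε K w (by omega) le_rfl
    rw [Nat.succ_mul] at h1
    omega
  omega

end Recognise

/-! ### Readings of markings placed at increasing positions -/

section Readings

variable {N n : ℕ}

/-- **A marking supported on strictly increasing positions reads off its labels in order.** [folklore] -/
theorem readMarks_eq_ofFn {pos : Fin n → Fin N} (hpos : StrictMono pos) (lab : Fin n → β)
    (M : Fin N → Option β) (hM : ∀ i, M (pos i) = some (lab i)) (hM' : ∀ x, (∀ i, pos i ≠ x) → M x = none) :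
    readMarks M = List.ofFn lab := by
  classical
  -- the marked positions, in order, are `pos 0 < pos 1 < ⋯`
  have hfilter : (List.finRange N).filter (fun x => (M x).isSome) = (List.finRange n).map pos := by
    apply List.Subset.antisymm_of_pairwise (r := (· < ·))
    · exact (List.pairwise_lt_finRange N).filter _
    · exact List.pairwise_map.2 ((List.pairwise_lt_finRange n).imp fun h => hpos h)
    · intro x hx
      rw [List.mem_filter] at hx
      by_cases h : ∃ i, pos i = x
      · obtain ⟨i, rfl⟩ := h
        exact List.mem_map.2 ⟨i, List.mem_finRange i, rfl⟩
      · push Not at h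
        rw [hM' x h] at hx
        simp at hx
    · intro x hx
      obtain ⟨i, -, rfl⟩ := List.mem_map.1 hx
      exact List.mem_filter.2 ⟨List.mem_finRange _, by rw [hM i]; rfl⟩
  -- `filterMap M` only sees the marked positions
  have key : ∀ l : List (Fin N), l.filterMap M = (l.filter fun x => (M x).isSome).filterMap M := by
    intro l
    induction l with
    | nil => rfl
    | cons x l ih =>
      rw [List.filterMap_cons, List.filter_cons]
      cases hx : M x with
      | none => simp [ih]
      | some b => simp [hx, ih]
  rw [readMarks, key, hfilter, List.filterMap_map]
  -- and on them reads the labels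
  have : ∀ l : List (Fin n), l.filterMap (M ∘ pos) = l.map lab := by
    intro l
    induction l with
    | nil => rfl
    | cons i l ih => rw [List.filterMap_cons, Function.comp_apply, hM i, List.map_cons, ih]
  rw [this, List.ofFn_eq_map]

end Readings

/-! ### The hard inequality: tracking the copies -/

section Main

variable {ε : β → ℕ} {K : ℕ}

/-- Positions stay inside: `(σᵒ ⟨s, _⟩) = ⟨s + o, _⟩` when `s + o < N`. [folklore] -/
theorem val_pow_apply_of_lt {N : ℕ} (x : Fin N) {o : ℕ} (h : x.val + o < N) : ((finRotate N ^ o) x).val = x.val + o := by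
  rw [Bardakov.val_finRotate_pow, Nat.mod_eq_of_lt h]

/-- A copy ends before the next letter begins. [folklore] -/
theorem start_add_le_offV_succ (v : List β) {i m : ℕ} (hi : i < v.length) (hm : m < K) :
    offV ε K v i + m * clen ε v[i] + clen ε v[i] ≤ offV ε K v (i + 1) := by
  rw [offV_succ ε K v hi, add_assoc, ← Nat.succ_mul]
  exact Nat.add_le_add_left (Nat.mul_le_mul_right _ hm) _

/-- A copy lies inside `λ(v)`. [folklore] -/
theorem start_add_le_length (v : List β) {i m : ℕ} (hi : i < v.length) (hm : m < K) :
    offV ε K v i + m * clen ε v[i] + clen ε v[i] ≤ (lam ε K v).length :=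
  (start_add_le_offV_succ v hi hm).trans (by rw [length_lam]; exact offV_mono ε K v hi le_rfl)

/-- Distinct copies occupy disjoint positions. [folklore] -/
theorem start_disjoint (v : List β) {i m o i' m' o' : ℕ} (hi : i < v.length) (hm : m < K) (ho : o < clen ε v[i])
    (hi' : i' < v.length) (hm' : m' < K) (ho' : o' < clen ε v[i']) (hne : (i, m) ≠ (i', m')) :
    offV ε K v i + m * clen ε v[i] + o ≠ offV ε K v i' + m' * clen ε v[i'] + o' := by
  intro h
  rcases lt_trichotomy i i' with hlt | rfl | hgt
  · have h1 := start_add_le_offV_succ (ε := ε) v hi hm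
    have h2 := offV_mono ε K v (show i + 1 ≤ i' by omega) hi'.le
    omega
  · have hmm : m ≠ m' := fun e => hne (by rw [e])
    rcases Nat.lt_or_gt_of_ne hmm with hlt | hgt
    · have : (m + 1) * clen ε v[i] ≤ m' * clen ε v[i] := Nat.mul_le_mul_right _ hlt
      rw [Nat.succ_mul] at this
      omega
    · have : (m' + 1) * clen ε v[i] ≤ m * clen ε v[i] := Nat.mul_le_mul_right _ hgt
      rw [Nat.succ_mul] at this
      omega
  · have h1 := start_add_le_offV_succ (ε := ε) v hi' hm'
    have h2 := offV_mono ε K v (show i' + 1 ≤ i by omega) hi.le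
    omega

/-- **No landing wraps around**: an interval carrying a letter code cannot straddle the end of
`λ(w)`, whose last and first letters are both `x`. [folklore] -/
theorem nowrap_of_letters (he1 : ∀ b, 1 ≤ ε b) {N : ℕ} (W' : Fin N → Fin 2) (hN : 0 < N)
    (h0 : W' ⟨0, hN⟩ = 0) (hlast : W' ⟨N - 1, by omega⟩ = 0) (P : Fin N) (b : β)
    (hfac : ∀ o (ho : o < clen ε b), W' ((finRotate N ^ o) P) = (hcode ε b)[o]'(by rw [length_hcode]; exact ho)) :
    P.val + clen ε b ≤ N := by
  by_contra hlt
  push Not at hlt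
  have hP := P.isLt
  obtain ⟨s, hs⟩ : ∃ s, s = N - 1 - P.val := ⟨_, rfl⟩
  have hs1 : s + 1 < clen ε b := by omega
  have hA : (finRotate N ^ s) P = ⟨N - 1, by omega⟩ := Fin.ext (by
    rw [Bardakov.val_finRotate_pow, Nat.mod_eq_of_lt (by omega)]; simp only []; omega)
  have hB : (finRotate N ^ (s + 1)) P = ⟨0, hN⟩ := Fin.ext (by
    rw [Bardakov.val_finRotate_pow, show P.val + (s + 1) = N by omega, Nat.mod_self])
  have e0 : (hcode ε b)[s]'(by rw [length_hcode, ← clen]; omega) = 0 := by rw [← hfac s (by omega), hA, hlast]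
  have e1 : (hcode ε b)[s + 1]'(by rw [length_hcode, ← clen]; omega) = 0 := by rw [← hfac (s + 1) hs1, hB, h0]
  exact hcode_no_xx he1 b hs1 e0 e1

/-- **Lemma 4.6, the hard inequality** (rigorous form): if `λ(v)` reaches a rotation of `λ(w)` in
`t` cyclic block interchanges and `K > 4t`, then `v` and `w` are related and `v` reaches a
rotation of `w` in `t` cyclic block interchanges. [cite: Heuer2020, Lemma 4.6] -/
theorem reach_of_reach_lam (he : Function.Injective ε) (he1 : ∀ b, 1 ≤ ε b) {v w : List β}
    (hn : w.length = v.length) {t : ℕ} (hK : 4 * t < K) (h : Reach t (lam ε K v) (lam ε K w)) :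
    List.Perm v w ∧ Reach t v w := by
  classical
  -- trivial case `v = []`
  rcases Nat.eq_zero_or_pos v.length with hv0 | hv0
  · rw [List.length_eq_zero_iff.1 hv0, List.length_eq_zero_iff.1 (hn.trans hv0)]
    exact ⟨List.Perm.refl _, (reach_zero.2 (List.IsRotated.refl _)).mono (Nat.zero_le _)⟩
  have hK1 : 0 < K := by omega
  set n := v.length with hndef
  set N := (lam ε K v).length with hNdef
  have hNw : (lam ε K w).length = N := by rw [hNdef]; exact (Reach.perm h).length_eq.symm
  -- the copies: `ι = Fin n × Fin K`, starts and lengths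
  let st : Fin n × Fin K → ℕ := fun κ => offV ε K v κ.1 + κ.2 * clen ε v[κ.1.val]
  have hst : ∀ κ : Fin n × Fin K, st κ + clen ε v[κ.1.val] ≤ N := fun κ => start_add_le_length v κ.1.isLt κ.2.isLt
  have hcl : ∀ b, 3 ≤ clen ε b := fun b => by have := he1 b; simp only [clen]; omega
  let start : Fin n × Fin K → Fin N := fun κ => ⟨st κ, by have := hst κ; have := hcl v[κ.1.val]; omega⟩
  let len : Fin n × Fin K → ℕ := fun κ => clen ε v[κ.1.val]
  have hpow : ∀ (κ : Fin n × Fin K) (o : ℕ), o < len κ → ((finRotate N ^ o) (start κ)).val = st κ + o := fun κ o ho =>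
    val_pow_apply_of_lt (start κ) (by have := hst κ; simp only [len] at ho; show st κ + o < N; omega)
  have hdisj : DisjointIv start len Finset.univ := by
    intro κ _ κ' _ hne o ho o' ho' heq
    have := congrArg Fin.val heq
    rw [hpow κ o ho, hpow κ' o' ho'] at this
    exact start_disjoint v κ.1.isLt κ.2.isLt ho κ'.1.isLt κ'.2.isLt ho'
      (fun e => hne (Prod.ext (Fin.ext (congrArg Prod.fst e :)) (Fin.ext (congrArg Prod.snd e :)))) this
  -- track
  have hU₀ : List.ofFn (fun x : Fin N => (lam ε K v)[x.val]) = lam ε K v := List.ofFn_getElem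
  rw [← hU₀] at h
  obtain ⟨Φ, U, S, hrot, hU, -, hcard, hrig, hread⟩ := exists_track start len h Finset.univ hdisj
  -- absorb the final rotation
  obtain ⟨W', k, hW', hUW⟩ := exists_comp_pow_of_isRotated (V := U) (v' := lam ε K w) hrot.symm
  set Ψ := finRotate N ^ k * Φ with hΨ
  have hW : ∀ x, W' (Ψ x) = (lam ε K v)[x.val] := fun x => by
    rw [hΨ, Perm.mul_apply, ← Function.comp_apply (f := W'), ← hUW, hU]
  have hW'get : ∀ y : Fin N, W' y = (lam ε K w)[y.val]'(by rw [hNw]; exact y.isLt) := fun y => by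
    simp only [hW', List.getElem_ofFn]
  have hc : ∀ (o : ℕ) (y : Fin N), (finRotate N ^ k) ((finRotate N ^ o) y) = (finRotate N ^ o) ((finRotate N ^ k) y) := by
    intro o y
    rw [← Perm.mul_apply, ← Perm.mul_apply, (Commute.pow_pow_self (finRotate N) k o).eq]
  have hrigΨ : ∀ κ ∈ S, ∀ o, o < len κ → Ψ ((finRotate N ^ o) (start κ)) = (finRotate N ^ o) (Ψ (start κ)) := by
    intro κ hκ o ho
    rw [hΨ, Perm.mul_apply, Perm.mul_apply, hrig κ hκ o ho, hc]
  have hreadΨ : ∀ M : Fin N → Option β, Reach t (readMarks M) (readMarks (M ∘ ⇑Ψ.symm)) := by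
    intro M
    have h1 := hread β M
    have h2 : List.IsRotated (readMarks ((M ∘ ⇑Φ.symm) ∘ ⇑(finRotate N ^ k)⁻¹)) (readMarks (M ∘ ⇑Φ.symm)) :=
      readMarks_comp_pow_inv_isRotated _ k
    rw [show (M ∘ ⇑Φ.symm) ∘ ⇑(finRotate N ^ k)⁻¹ = M ∘ ⇑Ψ.symm from by
      funext x; simp [hΨ, Perm.mul_def, Perm.inv_def]] at h2
    exact h1.isRotated_right h2.symm
  -- landing of a survivor: letters, no wrap-around, a block copy of the same letter
  have hletter : ∀ κ ∈ S, ∀ o (ho : o < len κ), W' ((finRotate N ^ o) (Ψ (start κ))) =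
      (hcode ε v[κ.1.val])[o]'(by rw [length_hcode]; exact ho) := by
    intro κ hκ o ho
    rw [← hrigΨ κ hκ o ho, hW]
    have e : ((finRotate N ^ o) (start κ)).val = offV ε K v κ.1 + κ.2 * clen ε v[κ.1.val] + o := hpow κ o ho
    simp only [e]
    exact lam_getElem ε K v κ.1.isLt κ.2.isLt ho _
  have hN0 : 0 < N := by
    have h1 := hst (⟨0, hv0⟩, ⟨0, hK1⟩)
    have h4 := hcl (v[0]'hv0)
    exact lt_of_lt_of_le (lt_of_lt_of_le (by decide) h4) ((Nat.le_add_left _ _).trans h1)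
  have hnowrap : ∀ κ ∈ S, (Ψ (start κ)).val + len κ ≤ N := by
    intro κ hκ
    refine nowrap_of_letters he1 W' hN0 ?_ ?_ (Ψ (start κ)) v[κ.1.val] (fun o ho => hletter κ hκ o ho)
    · rw [hW'get]
      exact lam_getElem_zero (ε := ε) (K := K) w (by rw [hNw]; exact hN0)
    · rw [hW'get]
      have := lam_getElem_last (ε := ε) (K := K) w (by rw [hNw]; exact hN0)
      simp only [hNw] at this
      exact this
  let cw : ℕ → ℕ := fun j => if h : j < w.length then clen ε w[j] else 0
  have hcw : ∀ (j : ℕ) (h : j < w.length), cw j = clen ε w[j] := fun j h => dif_pos h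
  have hland : ∀ κ ∈ S, ∃ (j : ℕ) (hj : j < w.length) (m : ℕ), m < K ∧
      (Ψ (start κ)).val = offV ε K w j + m * cw j ∧ w[j] = v[κ.1.val] := by
    intro κ hκ
    have hQ : (Ψ (start κ)).val + clen ε v[κ.1.val] ≤ (lam ε K w).length := by rw [hNw]; exact hnowrap κ hκ
    obtain ⟨j, hj, m, hm, hQe, hεj⟩ := exists_block_of_factor he1 w v[κ.1.val] hQ (fun o ho => by
      have := hletter κ hκ o ho
      rw [hW'get] at this
      have e : ((finRotate N ^ o) (Ψ (start κ))).val = (Ψ (start κ)).val + o :=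
        val_pow_apply_of_lt _ (by have := hnowrap κ hκ; show _ < N; simp only [len] at this; omega)
      simp only [e] at this
      exact this)
    exact ⟨j, hj, m, hm, by rw [hcw j hj]; exact hQe, he hεj⟩
  choose J hJ mJ hmJ hPJ hwJ using hland
  have hJn : ∀ κ (hκ : κ ∈ S), J κ hκ < n := fun κ hκ => lt_of_lt_of_eq (hJ κ hκ) hn
  -- landing is injective on survivors
  have hinjland : ∀ κ (hκ : κ ∈ S) κ' (hκ' : κ' ∈ S), J κ hκ = J κ' hκ' → mJ κ hκ = mJ κ' hκ' → κ = κ' := by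
    intro κ hκ κ' hκ' hj hm
    have hP : (Ψ (start κ)).val = (Ψ (start κ')).val := by rw [hPJ κ hκ, hPJ κ' hκ', hj, hm]
    have hs := congrArg Fin.val (Ψ.injective (Fin.ext hP))
    change st κ = st κ' at hs
    by_contra hne
    exact start_disjoint v (o := 0) (o' := 0) κ.1.isLt κ.2.isLt (lt_of_lt_of_le (by decide) (hcl _)) κ'.1.isLt κ'.2.isLt
      (lt_of_lt_of_le (by decide) (hcl _))
      (fun e => hne (Prod.ext (Fin.ext (congrArg Prod.fst e :)) (Fin.ext (congrArg Prod.snd e :)))) (by simpa using hs)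
  -- Hall's condition
  let T : Fin n → Finset (Fin n) := fun i =>
    (S.filter fun κ => κ.1 = i).attach.image fun κ => ⟨J κ.1 (Finset.mem_filter.1 κ.2).1, hJn _ _⟩
  have hall : ∀ I : Finset (Fin n), I.card ≤ (I.biUnion T).card := by
    intro I
    by_contra hlt
    push Not at hlt
    -- survivors with letter index in `I`
    set SI := S.filter fun κ => κ.1 ∈ I with hSI
    -- (1) many survivors: `|I| · K - 4t ≤ |SI|`
    have hbig : I.card * K ≤ SI.card + 4 * t := by
      have hprod : (Finset.univ.filter fun κ : Fin n × Fin K => κ.1 ∈ I).card = I.card * K := by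
        rw [show (Finset.univ.filter fun κ : Fin n × Fin K => κ.1 ∈ I) = I ×ˢ (Finset.univ : Finset (Fin K)) from by
          ext κ; simp, Finset.card_product, Finset.card_univ, Fintype.card_fin]
      have hsub : (Finset.univ.filter fun κ : Fin n × Fin K => κ.1 ∈ I) ⊆ SI ∪ (Finset.univ \ S) := by
        intro κ hκ
        rw [Finset.mem_filter] at hκ
        rw [Finset.mem_union, hSI, Finset.mem_filter, Finset.mem_sdiff]
        by_cases hs : κ ∈ S
        · exact Or.inl ⟨hs, hκ.2⟩
        · exact Or.inr ⟨Finset.mem_univ _, hs⟩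
      have := (Finset.card_le_card hsub).trans (Finset.card_union_le _ _)
      rw [hprod] at this
      omega
    -- (2) few landing places: `|SI| ≤ |⋃ T| · K`
    have hsmall : SI.card ≤ (I.biUnion T).card * K := by
      have hcp : ((I.biUnion T) ×ˢ (Finset.univ : Finset (Fin K))).card = (I.biUnion T).card * K := by
        rw [Finset.card_product, Finset.card_univ, Fintype.card_fin]
      rw [← hcp]
      refine Finset.card_le_card_of_injOn (fun κ => if hκ : κ ∈ S then
        (⟨J κ hκ, hJn κ hκ⟩, ⟨mJ κ hκ, hmJ κ hκ⟩) else (⟨0, hv0⟩, ⟨0, hK1⟩)) (fun κ hκ => ?_) ?_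
      · rw [Finset.mem_coe, hSI, Finset.mem_filter] at hκ
        simp only [dif_pos hκ.1, Finset.mem_coe, Finset.mem_product]
        refine ⟨Finset.mem_biUnion.2 ⟨κ.1, hκ.2, ?_⟩, Finset.mem_univ _⟩
        refine Finset.mem_image.2 ⟨⟨κ, Finset.mem_filter.2 ⟨hκ.1, rfl⟩⟩, Finset.mem_attach _ _, rfl⟩
      · intro κ hκ κ' hκ' hff
        rw [Finset.mem_coe, hSI, Finset.mem_filter] at hκ hκ'
        simp only [dif_pos hκ.1, dif_pos hκ'.1, Prod.mk.injEq, Fin.mk.injEq] at hff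
        exact hinjland κ hκ.1 κ' hκ'.1 hff.1 hff.2
    -- contradiction with `K > 4t`
    have hI : 1 ≤ I.card := by
      rcases Nat.eq_zero_or_pos I.card with h0 | h0
      · rw [h0] at hlt; exact absurd hlt (Nat.not_lt_zero _)
      · exact h0
    have h3 : SI.card ≤ (I.card - 1) * K := hsmall.trans (Nat.mul_le_mul_right _ (by omega))
    rw [Nat.sub_one_mul] at h3
    have : I.card * K ≥ K := Nat.le_mul_of_pos_left _ hI
    omega
  obtain ⟨f, hfinj, hfT⟩ := (Finset.all_card_le_biUnion_card_iff_exists_injective T).1 hall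
  -- the chosen survivors
  have hchoice : ∀ i, ∃ κ, ∃ hκ : κ ∈ S, κ.1 = i ∧ (⟨J κ hκ, hJn κ hκ⟩ : Fin n) = f i := by
    intro i
    have := hfT i
    simp only [T, Finset.mem_image, Finset.mem_attach, true_and, Subtype.exists, Finset.mem_filter] at this
    obtain ⟨κ, ⟨hκS, hκi⟩, hκJ⟩ := this
    exact ⟨κ, hκS, hκi, hκJ⟩
  choose c hcS hc1 hcJ using hchoice
  have hfbij : Function.Bijective f := Finite.injective_iff_bijective.1 hfinj
  have hwf : ∀ i, w[(f i).val]'(by rw [hn]; exact (f i).isLt) = v[i.val] := by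
    intro i
    have h1 := hwJ (c i) (hcS i)
    have h2 : (J (c i) (hcS i)) = (f i).val := congrArg Fin.val (hcJ i)
    simp only [h2, hc1] at h1
    exact h1
  -- `v` and `w` are related
  have hperm : List.Perm v w := by
    have hV : List.ofFn (fun i : Fin n => v[i.val]) = v := List.ofFn_getElem
    have hWl : List.ofFn (fun j : Fin n => w[j.val]'(by rw [hn]; exact j.isLt)) = w := by
      apply List.ext_getElem (by simp [hn]) fun i h1 h2 => by simp
    rw [← hV, ← hWl]
    exact IsMatching.perm (p := Equiv.ofBijective f hfbij) fun i => hwf i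
  refine ⟨hperm, ?_⟩
  -- the marking of the chosen survivors and its two readings
  have hc1v : ∀ i, ((c i).1 : ℕ) = i := fun i => congrArg Fin.val (hc1 i)
  have hstartinj : Function.Injective fun i => start (c i) := by
    intro i i' h
    have hs : st (c i) = st (c i') := congrArg Fin.val h
    by_contra hne
    have hne' : ((c i).1, (c i).2) ≠ ((c i').1, (c i').2) := by
      intro e
      apply hne
      apply Fin.ext
      rw [← hc1v i, ← hc1v i', show (c i).1 = (c i').1 from congrArg Prod.fst e]
    exact start_disjoint v (o := 0) (o' := 0) (c i).1.isLt (c i).2.isLt (lt_of_lt_of_le (by decide) (hcl _)) (c i').1.isLt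
      (c i').2.isLt (lt_of_lt_of_le (by decide) (hcl _)) (fun e => hne' (by
        simp only [Prod.mk.injEq] at e ⊢; exact ⟨Fin.ext e.1, Fin.ext e.2⟩)) (by simpa using hs)
  let M : Fin N → Option β := fun x => if h : ∃ i, start (c i) = x then some v[(Classical.choose h).val] else none
  have hM : ∀ i, M (start (c i)) = some v[i.val] := by
    intro i
    have hex : ∃ i', start (c i') = start (c i) := ⟨i, rfl⟩
    simp only [M, dif_pos hex]
    have := hstartinj (Classical.choose_spec hex)
    simp only [this]
  have hM' : ∀ x, (∀ i, start (c i) ≠ x) → M x = none := fun x hx => by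
    simp only [M]
    rw [dif_neg]
    rintro ⟨i, hi⟩
    exact hx i hi
  -- reading before: `v`
  have hmono₀ : StrictMono fun i : Fin n => start (c i) := by
    intro i i' hii'
    show st (c i) < st (c i')
    have hlt : (i : ℕ) < i' := hii'
    have h1 := start_add_le_offV_succ (ε := ε) v (c i).1.isLt (c i).2.isLt
    have h2 := offV_mono ε K v (show ((c i).1 : ℕ) + 1 ≤ (c i').1 by rw [hc1v, hc1v]; omega) (c i').1.isLt.le
    have := hcl v[(c i).1.val]
    simp only [st]
    omega
  have hread₀ : readMarks M = v := by
    rw [readMarks_eq_ofFn hmono₀ (fun i : Fin n => v[i.val]) M hM hM']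
    exact List.ofFn_getElem
  -- reading after: `w`
  let F : Fin n ≃ Fin n := Equiv.ofBijective f hfbij
  have hFf : ∀ i, F i = f i := fun _ => rfl
  let pos₁ : Fin n → Fin N := fun j => Ψ (start (c (F.symm j)))
  have hpos₁val : ∀ j : Fin n, (pos₁ j).val = offV ε K w j.val + mJ (c (F.symm j)) (hcS _) * clen ε (w[j.val]'(by
      rw [hn]; exact j.isLt)) := by
    intro j
    have := hPJ (c (F.symm j)) (hcS _)
    have hj : J (c (F.symm j)) (hcS _) = j.val := by
      have := congrArg Fin.val (hcJ (F.symm j))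
      rw [← hFf, Equiv.apply_symm_apply] at this
      exact this
    rw [hj, hcw j.val (by rw [hn]; exact j.isLt)] at this
    exact this
  have hmono₁ : StrictMono pos₁ := by
    intro j j' hjj'
    show (pos₁ j).val < (pos₁ j').val
    rw [hpos₁val, hpos₁val]
    have hj' : j'.val < w.length := by rw [hn]; exact j'.isLt
    have hj : j.val < w.length := by rw [hn]; exact j.isLt
    have h1 := start_add_le_offV_succ (ε := ε) w hj (hmJ (c (F.symm j)) (hcS _))
    have h2 := offV_mono ε K w (show j.val + 1 ≤ j'.val from hjj') hj'.le
    have := hcl w[j.val]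
    omega
  have hM₁ : ∀ j, (M ∘ ⇑Ψ.symm) (pos₁ j) = some (w[j.val]'(by rw [hn]; exact j.isLt)) := by
    intro j
    simp only [Function.comp_apply, pos₁, Equiv.symm_apply_apply, hM]
    rw [← hwf (F.symm j), Option.some.injEq]
    congr 1
    rw [← hFf, Equiv.apply_symm_apply]
  have hM₁' : ∀ x, (∀ j, pos₁ j ≠ x) → (M ∘ ⇑Ψ.symm) x = none := by
    intro x hx
    apply hM'
    intro i hi
    apply hx (F i)
    simp only [pos₁, Equiv.symm_apply_apply]
    rw [hi, Equiv.apply_symm_apply]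
  have hread₁ : readMarks (M ∘ ⇑Ψ.symm) = w := by
    rw [readMarks_eq_ofFn hmono₁ (fun j : Fin n => w[j.val]'(by rw [hn]; exact j.isLt)) _ hM₁ hM₁']
    apply List.ext_getElem (by simp [hn]) fun i h1 h2 => by simp
  have := hreadΨ M
  rwa [hread₀, hread₁] at this

/-- **Lemma 4.6**: `d_cbi(λ(v), λ(w)) = d_cbi(v, w)` for related `v, w` whenever the repetition
exceeds `4 d_cbi(v, w)` (so for `K > 4|v|`, in particular for the printed `K = 4n² + 1`).
[cite: Heuer2020, Lemma 4.6] -/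
theorem dcbi_lam_eq (he : Function.Injective ε) (he1 : ∀ b, 1 ≤ ε b) {v w : List β} (h : List.Perm v w)
    (hK : 4 * dcbi v w < K) : dcbi (lam ε K v) (lam ε K w) = dcbi v w := by
  refine le_antisymm (dcbi_lam_le ε K h) ?_
  have hle := dcbi_lam_le ε K h
  have hr := reach_dcbi ((reach_dcbi h).lam ε K).perm
  obtain ⟨-, hreach⟩ := reach_of_reach_lam he he1 h.length_eq.symm (lt_of_le_of_lt (Nat.mul_le_mul_left 4 hle) hK) hr
  exact dcbi_le_of_reach hreach

/-- **The decision form used by the reduction CBI-`F₄ ≤ₚ` CBI-`F₂`**: for words of equal length,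
`k ≤ |v|` and `K > 4|v|`, the pair `(λ v, λ w)` is a yes-instance with threshold `k` iff `(v, w)`
is (relatedness included on both sides). [cite: Heuer2020, Lemma 4.6] -/
theorem lam_yes_iff (he : Function.Injective ε) (he1 : ∀ b, 1 ≤ ε b) {v w : List β} (hn : w.length = v.length)
    {k : ℕ} (hk : k ≤ v.length) (hK : 4 * v.length < K) :
    (List.Perm (lam ε K v) (lam ε K w) ∧ dcbi (lam ε K v) (lam ε K w) ≤ k) ↔ (List.Perm v w ∧ dcbi v w ≤ k) := by
  constructor
  · rintro ⟨hp, hd⟩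
    obtain ⟨hvw, hreach⟩ := reach_of_reach_lam he he1 hn (lt_of_le_of_lt (Nat.mul_le_mul_left 4 (hd.trans hk)) hK)
      (reach_dcbi hp)
    exact ⟨hvw, (dcbi_le_of_reach hreach).trans hd⟩
  · rintro ⟨hp, hd⟩
    exact ⟨(reach_dcbi hp).lam ε K |>.perm, (dcbi_lam_le ε K hp).trans hd⟩

end Main

end CBI

end Literature.GroupTheory.CombinatorialGroupTheory
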